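import Literature.Analysis.Calculus.IteratedFDerivBasisBounds      -- ★ p850902 (LH3-p01 (g4)): `exists_norm_le_pow_mul_sum_norm_apply_basis`
import Literature.Analysis.Calculus.DirDerivOpenCommute            -- ★ p850920 (LH3-p01 (g4)): `dirDeriv_eqOn_of_eqOn`, `contDiffOn_dirDeriv`, `dirDeriv_comm_eqOn`
import Mathlib.Analysis.Calculus.FDeriv.Prod
import HarnessLib

/-!
# Words of directional derivatives: `iteratedFDeriv` on tuples as nested directional derivatives, Schwarz for words, and sections of a product
# (Hörmander ALPDO I §1.1: the jets of a `C^∞` function are its mixed partial derivatives, in any order)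

Topic `Analysis/Calculus`; namespace `Literature.Analysis.Calculus`.  THEOREMS ONLY (no `def`, no instance, no axiom, no `sorry`).  Generic multivariable calculus, third part of
★ `IteratedFDerivBasisBounds` ∕ ★ `DirDerivOpenCommute` (cell `pub/hodgecm-mathlib`, crux H413 = `stmt-HodgeConjecture-24833`, line LH3, organ O-L3′ (ii), stage (α4-S5♭) «JETS from the
engine» of LH3-p01 (g5)'s plan; count-neutral).  A WORD is a list `l : List V` of directions; it acts on `g : V → F` by the nested directional derivatives
`l.foldr (fun v h y => fderiv ℝ h y v) g` (the head of the list is the OUTERMOST derivative), written out literally everywhere (no definition).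
* §1 **words are local and smooth on an open set** (`foldr_dirDeriv_eqOn_of_eqOn`, `contDiffOn_foldr_dirDeriv`), and **`iteratedFDeriv ℝ n g x v = (List.ofFn v).foldr … g x`** for `g`
  `C^∞` on an open `U ∋ x` (`iteratedFDeriv_apply_eq_foldr_dirDeriv`; Mathlib `DifferentiableAt.iteratedFDeriv_succ_apply_left'`); hence with ★ `exists_norm_le_pow_mul_sum_norm_apply_basis`
  the ORDER-ZERO REDUCTION **`exists_forall_norm_iteratedFDeriv_le_pow_mul_sum_norm_foldr`**: `‖iteratedFDeriv ℝ n g x‖ ≤ Cⁿ · Σ_{I : Fin n → κ} ‖(basis word b ∘ I) g (x)‖`.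
* §2 **SCHWARZ FOR WORDS**: `D_u (word_l g) = word_l (D_u g)` on `U` (`dirDeriv_foldr_comm_eqOn`, from ★ `dirDeriv_comm_eqOn` letter by letter).
* §3 **SECTIONS OF A PRODUCT** `V₁ × V₂`: the directional derivative along `(u, 0)` is the derivative of the section `y₁ ↦ g (y₁, x₂)` (`fderiv_apply_inl_eq_fderiv_section`), the same for
  words (`foldr_dirDeriv_inl_eq_section`), hence **`iteratedFDeriv ℝ n (fun y₁ => g (y₁, x₂)) x₁ v = ((List.ofFn v).map (·, 0)).foldr … g (x₁, x₂)`**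
  (`iteratedFDeriv_section_apply_eq_foldr`) — the jets of a section on tuples are words of the joint function.
USE (LH3 (α4-S5♭)): the `k`-fold Casimir engine bounds the jets of the `ψ`-SECTIONS of the normalised orbital functional `F(ψ, d)` on basis tuples; §3+§1 read them as `ψ`-words of `F`,
§2 moves the `d`-letters of a mixed word inside (where they act on the integrand), §1 turns the resulting order-`0` bounds of all words into bounds of `‖iteratedFDeriv ℝ n F‖`.
HONEST LABEL: generic calculus; HC_CM is proved only modulo the 7 printed citations (2 remaining: hLiu418 = stmt-HodgeConjecture-24832, h413 = stmt-HodgeConjecture-24833) until rung 0 closes.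

## References
* [HormanderALPDO1] L. Hörmander, *The Analysis of Linear Partial Differential Operators I*, 2nd ed. (1990), §1.1 pp. 7–12 (Thms. 1.1.6–1.1.9).
-/

set_option autoImplicit false

noncomputable section

open Set Filter Topology Function
open scoped ContDiff

namespace Literature.Analysis.Calculus

/-! ## §1 Words: locality, smoothness, and `iteratedFDeriv` on tuples -/

section Words

variable {V : Type*} [NormedAddCommGroup V] [NormedSpace ℝ V] {F : Type*} [NormedAddCommGroup F] [NormedSpace ℝ F]

/-- **Words are local**: if `g₁ = g₂` on the open `U` then `word_l g₁ = word_l g₂` on `U` (★ `dirDeriv_eqOn_of_eqOn`, letter by letter). [cite: HormanderALPDO1, §1.1 pp. 7–12] -/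
theorem foldr_dirDeriv_eqOn_of_eqOn {U : Set V} (hU : IsOpen U) (l : List V) :
    ∀ {g₁ g₂ : V → F}, EqOn g₁ g₂ U →
      EqOn (l.foldr (fun v h y => fderiv ℝ h y v) g₁) (l.foldr (fun v h y => fderiv ℝ h y v) g₂) U := by
  induction l with
  | nil => intro g₁ g₂ h; simpa using h
  | cons v l ih =>
    intro g₁ g₂ h
    rw [List.foldr_cons, List.foldr_cons]
    exact dirDeriv_eqOn_of_eqOn hU (ih h) v

/-- **Words preserve `C^∞` on an open set** (★ `contDiffOn_dirDeriv`, letter by letter). [cite: HormanderALPDO1, §1.1 pp. 7–12] -/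
theorem contDiffOn_foldr_dirDeriv {U : Set V} (hU : IsOpen U) (l : List V) :
    ∀ {g : V → F}, ContDiffOn ℝ ∞ g U → ContDiffOn ℝ ∞ (l.foldr (fun v h y => fderiv ℝ h y v) g) U := by
  induction l with
  | nil => intro g hg; simpa using hg
  | cons v l ih =>
    intro g hg
    rw [List.foldr_cons]
    exact contDiffOn_dirDeriv hU (ih hg) v

/-- **`iteratedFDeriv` ON A TUPLE IS THE WORD OF NESTED DIRECTIONAL DERIVATIVES**: for `g` `C^∞` on the open `U ∋ x` and `v : Fin n → V`,
`iteratedFDeriv ℝ n g x v = (∂_{v 0} ∂_{v 1} ⋯ ∂_{v (n-1)} g)(x) = (List.ofFn v).foldr (fun u h y => fderiv ℝ h y u) g x` (Mathlib `DifferentiableAt.iteratedFDeriv_succ_apply_left'`, by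
induction on `n`, the inner identity holding on all of `U`). [cite: HormanderALPDO1, §1.1 pp. 7–12] -/
theorem iteratedFDeriv_apply_eq_foldr_dirDeriv {U : Set V} (hU : IsOpen U) {n : ℕ} :
    ∀ {g : V → F}, ContDiffOn ℝ ∞ g U → ∀ {x : V}, x ∈ U → ∀ v : Fin n → V,
      iteratedFDeriv ℝ n g x v = (List.ofFn v).foldr (fun u h y => fderiv ℝ h y u) g x := by
  induction n with
  | zero => intro g _ x _ v; simp
  | succ n ih =>
    intro g hg x hx v
    have hd : DifferentiableAt ℝ (iteratedFDeriv ℝ n g) x :=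
      (hg.contDiffAt (hU.mem_nhds hx)).differentiableAt_iteratedFDeriv (by exact_mod_cast ENat.coe_lt_top n)
    rw [hd.iteratedFDeriv_succ_apply_left', List.ofFn_succ, List.foldr_cons]
    -- the inner functions agree on the open `U ∋ x`
    have heq : (fun y => iteratedFDeriv ℝ n g y (Fin.tail v)) =ᶠ[𝓝 x] (List.ofFn fun i => v i.succ).foldr (fun u h y => fderiv ℝ h y u) g := by
      filter_upwards [hU.mem_nhds hx] with y hy
      exact ih hg hy (Fin.tail v)
    rw [heq.fderiv_eq]

/-- **ORDER-ZERO REDUCTION**: for a basis `b` of a finite-dimensional `V` there is `C ≥ 0` (depending only on `b`) with, for every `g` `C^∞` on an open `U ∋ x` and every `n`,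
`‖iteratedFDeriv ℝ n g x‖ ≤ Cⁿ · Σ_{I : Fin n → κ} ‖(word b∘I) g (x)‖` (★ `exists_norm_le_pow_mul_sum_norm_apply_basis` + `iteratedFDeriv_apply_eq_foldr_dirDeriv`): bounds on all jets follow from
ORDER-`0` bounds of all basis words. [cite: HormanderALPDO1, §1.1 pp. 7–12] -/
theorem exists_forall_norm_iteratedFDeriv_le_pow_mul_sum_norm_foldr {κ : Type*} [Fintype κ] (b : Module.Basis κ ℝ V) :
    ∃ C : ℝ, 0 ≤ C ∧ ∀ (n : ℕ) {U : Set V}, IsOpen U → ∀ {g : V → F}, ContDiffOn ℝ ∞ g U → ∀ {x : V}, x ∈ U →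
      ‖iteratedFDeriv ℝ n g x‖ ≤ C ^ n * ∑ I : Fin n → κ, ‖(List.ofFn fun k => b (I k)).foldr (fun u h y => fderiv ℝ h y u) g x‖ := by
  obtain ⟨C, hC0, hC⟩ := exists_norm_le_pow_mul_sum_norm_apply_basis (F := F) b
  refine ⟨C, hC0, fun n U hU g hg x hx => (hC n (iteratedFDeriv ℝ n g x)).trans_eq ?_⟩
  congr 1
  exact Finset.sum_congr rfl fun I _ => by rw [iteratedFDeriv_apply_eq_foldr_dirDeriv hU hg hx]

end Words

/-! ## §2 Schwarz for words: `D_u (word_l g) = word_l (D_u g)` on an open set -/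

section Schwarz

variable {V : Type*} [NormedAddCommGroup V] [NormedSpace ℝ V] {F : Type*} [NormedAddCommGroup F] [NormedSpace ℝ F]

/-- **SCHWARZ FOR WORDS**: for `g` `C^∞` on the open `U`, a direction `u` and a word `l`, `D_u (word_l g) = word_l (D_u g)` on `U` — ★ `dirDeriv_comm_eqOn` moves `u` past each letter, the
words being `C^∞` on `U` (§1). [cite: HormanderALPDO1, §1.1 Thm. 1.1.8] -/
theorem dirDeriv_foldr_comm_eqOn {U : Set V} (hU : IsOpen U) (u : V) (l : List V) :
    ∀ {g : V → F}, ContDiffOn ℝ ∞ g U →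
      EqOn (fun y => fderiv ℝ (l.foldr (fun v h y => fderiv ℝ h y v) g) y u)
        (l.foldr (fun v h y => fderiv ℝ h y v) (fun y => fderiv ℝ g y u)) U := by
  induction l with
  | nil => intro g _ y _; simp
  | cons v l ih =>
    intro g hg
    rw [List.foldr_cons, List.foldr_cons]
    -- `D_u D_v (word_l g) = D_v D_u (word_l g) = D_v (word_l (D_u g))` on `U`
    have h1 := dirDeriv_comm_eqOn hU (contDiffOn_foldr_dirDeriv hU l hg) u v
    have h2 : EqOn (fun y => fderiv ℝ (fun z => fderiv ℝ (l.foldr (fun v h y => fderiv ℝ h y v) g) z u) y v)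
        (fun y => fderiv ℝ (l.foldr (fun v h y => fderiv ℝ h y v) (fun y => fderiv ℝ g y u)) y v) U :=
      dirDeriv_eqOn_of_eqOn hU (ih hg) v
    exact h1.trans h2

end Schwarz

/-! ## §3 Sections of a product: derivatives along `(u, 0)` are derivatives of the section -/

section Section

variable {V₁ : Type*} [NormedAddCommGroup V₁] [NormedSpace ℝ V₁] {V₂ : Type*} [NormedAddCommGroup V₂] [NormedSpace ℝ V₂]
  {F : Type*} [NormedAddCommGroup F] [NormedSpace ℝ F]

/-- **`Dg(x₁,x₂)·(u,0) = D[g(·,x₂)](x₁)·u`** for `g` differentiable at `(x₁, x₂)` (chain rule with `y₁ ↦ (y₁, x₂)`, derivative `inl`). [cite: HormanderALPDO1, §1.1 pp. 7–12] -/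
theorem fderiv_apply_inl_eq_fderiv_section {g : V₁ × V₂ → F} {x₁ : V₁} {x₂ : V₂} (hg : DifferentiableAt ℝ g (x₁, x₂)) (u : V₁) :
    fderiv ℝ g (x₁, x₂) (u, 0) = fderiv ℝ (fun y₁ => g (y₁, x₂)) x₁ u := by
  have h : HasFDerivAt (fun y₁ => g (y₁, x₂)) ((fderiv ℝ g (x₁, x₂)).comp (ContinuousLinearMap.inl ℝ V₁ V₂)) x₁ :=
    hg.hasFDerivAt.comp x₁ (hasFDerivAt_prodMk_left x₁ x₂)
  rw [h.fderiv, ContinuousLinearMap.comp_apply, ContinuousLinearMap.inl_apply]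

/-- **Words along `(u, 0)` are words of the section**: for `g` `C^∞` on the open `U ⊆ V₁ × V₂` and `x ∈ U`,
`(l.map (·,0)).foldr … g x = l.foldr … (y₁ ↦ g (y₁, x.2)) x.1` (induction on `l`; the inner identity holds on the open section set). [cite: HormanderALPDO1, §1.1 pp. 7–12] -/
theorem foldr_dirDeriv_inl_eq_section {U : Set (V₁ × V₂)} (hU : IsOpen U) {g : V₁ × V₂ → F} (hg : ContDiffOn ℝ ∞ g U) (l : List V₁) :
    ∀ x ∈ U, (l.map fun u => ((u, 0) : V₁ × V₂)).foldr (fun v h y => fderiv ℝ h y v) g x =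
      l.foldr (fun u h y₁ => fderiv ℝ h y₁ u) (fun y₁ => g (y₁, x.2)) x.1 := by
  induction l with
  | nil => intro x _; simp
  | cons u l ih =>
    rintro ⟨x₁, x₂⟩ hx
    rw [List.map_cons, List.foldr_cons, List.foldr_cons]
    -- the word `word_{l♯} g` is `C^∞` on `U`, differentiate its section
    have hsm : ContDiffOn ℝ ∞ ((l.map fun u => ((u, 0) : V₁ × V₂)).foldr (fun v h y => fderiv ℝ h y v) g) U := contDiffOn_foldr_dirDeriv hU _ hg
    have hd : DifferentiableAt ℝ ((l.map fun u => ((u, 0) : V₁ × V₂)).foldr (fun v h y => fderiv ℝ h y v) g) (x₁, x₂) :=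
      (hsm.differentiableOn (by simp)).differentiableAt (hU.mem_nhds hx)
    rw [fderiv_apply_inl_eq_fderiv_section hd]
    -- near `x₁` the section of the word is the word of the section (IH on the open section set)
    have hopen : IsOpen {y₁ : V₁ | (y₁, x₂) ∈ U} := hU.preimage (continuous_id.prodMk continuous_const)
    have heq : (fun y₁ => (l.map fun u => ((u, 0) : V₁ × V₂)).foldr (fun v h y => fderiv ℝ h y v) g (y₁, x₂)) =ᶠ[𝓝 x₁]
        l.foldr (fun u h y₁ => fderiv ℝ h y₁ u) (fun y₁ => g (y₁, x₂)) := by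
      filter_upwards [hopen.mem_nhds (show x₁ ∈ {y₁ : V₁ | (y₁, x₂) ∈ U} from hx)] with y₁ hy₁
      exact ih (y₁, x₂) hy₁
    rw [heq.fderiv_eq]

/-- The section `y₁ ↦ g (y₁, x₂)` of a function `C^∞` on the open `U` is `C^∞` on the open section set `{y₁ | (y₁, x₂) ∈ U}`. [cite: HormanderALPDO1, §1.1 pp. 7–12] -/
theorem contDiffOn_section_fst {U : Set (V₁ × V₂)} {g : V₁ × V₂ → F} (hg : ContDiffOn ℝ ∞ g U) (x₂ : V₂) :
    ContDiffOn ℝ ∞ (fun y₁ => g (y₁, x₂)) {y₁ : V₁ | (y₁, x₂) ∈ U} :=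
  hg.comp (contDiff_id.prodMk contDiff_const).contDiffOn fun _ hy => hy

/-- **JETS OF A SECTION ON TUPLES ARE WORDS OF THE JOINT FUNCTION**: for `g` `C^∞` on the open `U ∋ (x₁, x₂)` and `v : Fin n → V₁`,
`iteratedFDeriv ℝ n (fun y₁ => g (y₁, x₂)) x₁ v = ((List.ofFn v).map (·, 0)).foldr (fun w h y => fderiv ℝ h y w) g (x₁, x₂)` (§1 for the section + `foldr_dirDeriv_inl_eq_section`).
[cite: HormanderALPDO1, §1.1 pp. 7–12] -/
theorem iteratedFDeriv_section_apply_eq_foldr {U : Set (V₁ × V₂)} (hU : IsOpen U) {g : V₁ × V₂ → F} (hg : ContDiffOn ℝ ∞ g U) {x₁ : V₁} {x₂ : V₂}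
    (hx : (x₁, x₂) ∈ U) {n : ℕ} (v : Fin n → V₁) :
    iteratedFDeriv ℝ n (fun y₁ => g (y₁, x₂)) x₁ v = ((List.ofFn v).map fun u => ((u, 0) : V₁ × V₂)).foldr (fun w h y => fderiv ℝ h y w) g (x₁, x₂) := by
  have hopen : IsOpen {y₁ : V₁ | (y₁, x₂) ∈ U} := hU.preimage (continuous_id.prodMk continuous_const)
  rw [iteratedFDeriv_apply_eq_foldr_dirDeriv hopen (contDiffOn_section_fst hg x₂) (show x₁ ∈ {y₁ : V₁ | (y₁, x₂) ∈ U} from hx) v,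
    foldr_dirDeriv_inl_eq_section hU hg (List.ofFn v) (x₁, x₂) hx]

/-- **Norm form**: `‖word_{(ofFn v)♯} g (x₁,x₂)‖ = ‖iteratedFDeriv ℝ n (g(·,x₂)) x₁ v‖` — the order-`0` size of a `V₁`-word of the joint function is read off the jets of the section.
[cite: HormanderALPDO1, §1.1 pp. 7–12] -/
theorem norm_foldr_dirDeriv_inl_eq_norm_iteratedFDeriv_section {U : Set (V₁ × V₂)} (hU : IsOpen U) {g : V₁ × V₂ → F} (hg : ContDiffOn ℝ ∞ g U) {x₁ : V₁} {x₂ : V₂}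
    (hx : (x₁, x₂) ∈ U) {n : ℕ} (v : Fin n → V₁) :
    ‖((List.ofFn v).map fun u => ((u, 0) : V₁ × V₂)).foldr (fun w h y => fderiv ℝ h y w) g (x₁, x₂)‖ = ‖iteratedFDeriv ℝ n (fun y₁ => g (y₁, x₂)) x₁ v‖ := by
  rw [iteratedFDeriv_section_apply_eq_foldr hU hg hx v]

end Section

end Literature.Analysis.Calculus

end
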